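import Mathlib
import Summits.NavierStokesRegularity.NavierStokesRegularity.Theorems.EulerZoomLiouvillePowerGaugeEulerLiouvilleSwirlCapacityAxisFloorPlanar
import Summits.NavierStokesRegularity.NavierStokesRegularity.Theorems.EulerZoomLiouvillePowerGaugeEulerLiouvilleSwirlCapacityAxisFloorMeridional
import Summits.NavierStokesRegularity.NavierStokesRegularity.Theorems.EulerZoomLiouvillePowerGaugeEulerLiouvilleSwirlCapacityAxisFloorTools
import Literature.Analysis.FluidPDE.AxisymShellLadyzhenskaya
import Literature.Analysis.FluidPDE.AxisymmetricEuler
import HarnessLib.Audit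

/-!
# Crux E `PowerGaugeEulerLiouville` (stmt-NavierStokesRegularity-19832), line `swirl-capacity`, stub D2 — part 4:
# THE AXIS CAPACITY FLOOR, POWER-LOSSY FORM (`∫_{B(0,3A)} |∇f|²/r² ≥ K_q γ₀² (V/A³)^{2/q} / A`)

Route `EulerZoomLiouville` (NavierStokesRegularity), crux E.  Line `swirl-capacity` (ns-idea-11 g3, LINE D), stub D2 `stub_axisCapacityFloor`,
in the critic's power-lossy re-cut (idea-crit-8 g2 V29, price P3): for every exponent `q ≥ 2` there is `K_q > 0` such that an axisymmetric `C¹`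
scalar `f` on `ℝ³` vanishing on the symmetry axis, `≥ γ₀ > 0` on a measurable `T ⊆ B(0,A)` of volume `≥ V`, has
`∫_{B(0,3A)} ‖∇f‖²/r² dx ≥ K_q γ₀² (V/A³)^{2/q} / A`  (`axisCapacityFloorPow`).  (The registered log-sharp floor `K γ₀²/(A(1+log⁺(A³/V)))`
would need the sharp planar Moser–Trudinger growth; the power form wins the line's exponent race with the same threshold `κ > (1−ρ)/(2−ρ)`.)

PROOF.  Meridional profile `g(z,ρ) = f(ρ,0,z)` on `ℝ × ℝ` (`g(z,0) = 0`, `|∂_ρ g| ≤ ‖∇f‖`, `‖∇g‖ ≤ 2‖∇f‖`); cut-off `χ_A(y) = χ₁(y/A)` with a fixed bump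
`χ₁` (`= 1` on `‖y‖ ≤ A`, `= 0` on `‖y‖ ≥ 2A`, `‖∇χ_A‖ ≤ C₁/A`); `h = χ_A g` is `C¹`, compactly supported in the square `Q = [−2A,2A]²` and `≥ γ₀` on
the meridional section of the blob.  Part 1 (`planar_superlevel_floor`): `γ₀² |Sec|^{2/q} ≤ C² |Q|^{2/q} ∫‖∇h‖²`.  Energy budget:
`‖∇h‖² ≤ 2‖∇g‖² + 2 g² C₁²/A²` on `Q`; RAY POINCARÉ from the grounded axis `g(z,ρ)² ≤ |ρ| |∫₀^ρ |∂_ρ g|²| ≤ 2A ∫_{−2A}^{2A} ‖∇f(s,0,z)‖² ds`,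
so `∫_Q g² ≤ 8A² ∫_Q ‖∇f∘m‖²`; the square is two copies of the half-square (`ρ ↦ −ρ` is the rotation `R_π`); and part 2
(`meridional_energy_le`): `2π ∫_{half-square} ‖∇f∘m‖²/ρ ≤ ∫_{B(3A)} ‖∇f‖²/r²`, `volume_le_meridional_section`: `|T| ≤ 2πA |Sec|`.

WHAT THIS IS NOT: not NS regularity, not the crux E — a helper `--supports` stmt-19832 (pure real analysis) toward a stratum statement about a
hypothetical Euler zoom-limit class (the velocity form and the endgame in the power form are the sequels).  [folklore]
-/

noncomputable section

set_option linter.dupNamespace false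

open MeasureTheory Set Filter Topology Metric Function
open scoped NNReal ENNReal

namespace Summit.NavierStokesRegularity.NavierStokesRegularity.Theorems.PowerGaugeEulerLiouville.SwirlCapacity

open Literature.Analysis Literature.Analysis.FluidPDE
/-! ### From the full square to the half square, and the energy of the cut-off profile -/

/-- The full square is two half-squares: `‖∇f(−ρ,0,z)‖ = ‖∇f(ρ,0,z)‖` (the reflection `ρ ↦ −ρ` is the rotation `R_π`), so
`∫_{[−2A,2A]²} ‖∇f∘m‖² ≤ 2 ∫_{[−2A,2A]×(0,2A]} ‖∇f∘m‖²`. [folklore] -/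
theorem square_le_two_half {f : EuclideanSpace ℝ (Fin 3) → ℝ} (hf : IsAxisymmetricScalar f) (hfd : ContDiff ℝ 1 f) (A : ℝ) :
    ∫⁻ y in Icc (-(2 * A)) (2 * A) ×ˢ Icc (-(2 * A)) (2 * A), ENNReal.ofReal (‖fderiv ℝ f (WithLp.toLp 2 ![y.2, 0, y.1])‖ ^ 2) ≤
      2 * ∫⁻ y in Icc (-(2 * A)) (2 * A) ×ˢ Ioc (0 : ℝ) (2 * A), ENNReal.ofReal (‖fderiv ℝ f (WithLp.toLp 2 ![y.2, 0, y.1])‖ ^ 2) := by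
  have hnorm : IsAxisymmetricScalar fun x => ‖fderiv ℝ f x‖ := hf.norm_fderiv (hfd.differentiable one_ne_zero)
  set J : Set ℝ := Icc (-(2 * A)) (2 * A) with hJ
  have hmerid : Continuous fun y : ℝ × ℝ => (WithLp.toLp 2 ![y.2, 0, y.1] : EuclideanSpace ℝ (Fin 3)) := by
    refine (PiLp.continuous_toLp 2 _).comp (continuous_pi fun i => ?_)
    fin_cases i
    · exact continuous_snd
    · exact continuous_const
    · exact continuous_fst
  set H : ℝ × ℝ → ℝ≥0∞ := fun y => ENNReal.ofReal (‖fderiv ℝ f (WithLp.toLp 2 ![y.2, 0, y.1])‖ ^ 2) with hH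
  have hHm : Measurable H :=
    ENNReal.measurable_ofReal.comp (((hfd.continuous_fderiv one_ne_zero).comp hmerid).norm.pow 2).measurable
  -- reflection symmetry `H (z, -ρ) = H (z, ρ)`
  have hrefl : ∀ z ρ : ℝ, H (z, -ρ) = H (z, ρ) := by
    intro z ρ
    simp only [hH]
    have e : (WithLp.toLp 2 ![-ρ, 0, z] : EuclideanSpace ℝ (Fin 3)) = rotZ Real.pi (WithLp.toLp 2 ![ρ, 0, z]) := by
      ext i
      fin_cases i <;> simp [rotZ]
    have h := hnorm Real.pi (WithLp.toLp 2 ![ρ, 0, z])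
    dsimp only at h
    rw [e, h]
  -- one-dimensional: `∫_{[-2A,2A]} H(z,·) ≤ 2 ∫_{(0,2A]} H(z,·)`
  have hz : ∀ z : ℝ, ∫⁻ ρ in J, H (z, ρ) ≤ 2 * ∫⁻ ρ in Ioc 0 (2 * A), H (z, ρ) := by
    intro z
    have hHz : Measurable fun ρ => H (z, ρ) := hHm.comp (measurable_const.prodMk measurable_id)
    have hsplit : J ⊆ Icc (-(2 * A)) 0 ∪ Ioc 0 (2 * A) := by
      intro ρ hρ
      rcases le_or_gt ρ 0 with h | h
      · exact Or.inl ⟨hρ.1, h⟩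
      · exact Or.inr ⟨h, hρ.2⟩
    have hneg : ∫⁻ ρ in Icc (-(2 * A)) 0, H (z, ρ) = ∫⁻ ρ in Icc 0 (2 * A), H (z, ρ) := by
      have h1 := (Measure.measurePreserving_neg (volume : Measure ℝ)).setLIntegral_comp_preimage_emb
        (MeasurableEquiv.neg ℝ).measurableEmbedding (fun ρ => H (z, ρ)) (Icc 0 (2 * A))
      have hpre : Neg.neg ⁻¹' Icc (0 : ℝ) (2 * A) = Icc (-(2 * A)) 0 := by
        ext ρ; simp only [mem_preimage, mem_Icc]; constructor <;> intro h <;> constructor <;> linarith [h.1, h.2]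
      rw [hpre] at h1
      rw [← h1]
      refine lintegral_congr fun ρ => ?_
      exact (hrefl z ρ).symm
    have hIcc : ∫⁻ ρ in Icc 0 (2 * A), H (z, ρ) = ∫⁻ ρ in Ioc 0 (2 * A), H (z, ρ) :=
      setLIntegral_congr Ioc_ae_eq_Icc.symm
    calc ∫⁻ ρ in J, H (z, ρ) ≤ ∫⁻ ρ in Icc (-(2 * A)) 0 ∪ Ioc 0 (2 * A), H (z, ρ) := lintegral_mono_set hsplit
      _ ≤ (∫⁻ ρ in Icc (-(2 * A)) 0, H (z, ρ)) + ∫⁻ ρ in Ioc 0 (2 * A), H (z, ρ) := lintegral_union_le _ _ _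
      _ = 2 * ∫⁻ ρ in Ioc 0 (2 * A), H (z, ρ) := by rw [hneg, hIcc, ← two_mul]
  have hμ1 : ((volume : Measure ℝ).restrict J).prod ((volume : Measure ℝ).restrict J) =
      (volume : Measure (ℝ × ℝ)).restrict (J ×ˢ J) := by
    rw [Measure.prod_restrict, ← Measure.volume_eq_prod]
  have hμ2 : ((volume : Measure ℝ).restrict J).prod ((volume : Measure ℝ).restrict (Ioc 0 (2 * A))) =
      (volume : Measure (ℝ × ℝ)).restrict (J ×ˢ Ioc 0 (2 * A)) := by
    rw [Measure.prod_restrict, ← Measure.volume_eq_prod]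
  rw [← hμ1, lintegral_prod _ (by rw [hμ1]; exact hHm.aemeasurable), ← hμ2,
    lintegral_prod _ (by rw [hμ2]; exact hHm.aemeasurable), ← lintegral_const_mul' _ _ (by norm_num)]
  exact lintegral_mono fun z => hz z

/-! ### The energy of the cut-off profile -/

/-- **Energy of the cut-off profile.**  With `g = f ∘ m`, a cut-off `χ` as in `exists_scaled_bump` and `h = χ · g`:
`∫ ‖∇h‖² ≤ (8 + 16 C₁²) ∫_{[−2A,2A]²} ‖∇f ∘ m‖²` (product rule, `‖∇g‖ ≤ 2‖∇f∘m‖`, ray Poincaré for the cut-off term). [folklore] -/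
theorem cutoff_energy_le {f : EuclideanSpace ℝ (Fin 3) → ℝ} (hfd : ContDiff ℝ 1 f)
    (haxis : ∀ x : EuclideanSpace ℝ (Fin 3), cylRadius x = 0 → f x = 0) {A C₁ : ℝ} (hA : 0 < A) (hC₁ : 0 ≤ C₁)
    {χ : ℝ × ℝ → ℝ} (hχd : ContDiff ℝ 1 χ) (hχ01 : ∀ y, 0 ≤ χ y ∧ χ y ≤ 1) (hχ0 : ∀ y, 2 * A ≤ ‖y‖ → χ y = 0)
    (hχD0 : ∀ y, 2 * A < ‖y‖ → fderiv ℝ χ y = 0) (hχD : ∀ y, ‖fderiv ℝ χ y‖ ≤ C₁ / A) :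
    ∫⁻ y, ‖fderiv ℝ (fun y : ℝ × ℝ => χ y * f (WithLp.toLp 2 ![y.2, 0, y.1])) y‖ₑ ^ (2 : ℝ) ≤
      ENNReal.ofReal (8 + 16 * C₁ ^ 2) *
        ∫⁻ y in Icc (-(2 * A)) (2 * A) ×ˢ Icc (-(2 * A)) (2 * A), ENNReal.ofReal (‖fderiv ℝ f (WithLp.toLp 2 ![y.2, 0, y.1])‖ ^ 2) := by
  obtain ⟨hgd, hgD⟩ := meridional_contDiff_and_norm_fderiv_le hfd
  set g : ℝ × ℝ → ℝ := fun y => f (WithLp.toLp 2 ![y.2, 0, y.1]) with hg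
  set Q : Set (ℝ × ℝ) := Icc (-(2 * A)) (2 * A) ×ˢ Icc (-(2 * A)) (2 * A) with hQ
  have hQm : MeasurableSet Q := measurableSet_Icc.prod measurableSet_Icc
  have hQmem : ∀ y : ℝ × ℝ, ‖y‖ ≤ 2 * A → y ∈ Q := by
    intro y hy
    have h1 : |y.1| ≤ 2 * A := (norm_fst_le y).trans hy
    have h2 : |y.2| ≤ 2 * A := (norm_snd_le y).trans hy
    exact ⟨abs_le.1 h1 |> fun h => ⟨by linarith [h.1], h.2⟩, abs_le.1 h2 |> fun h => ⟨by linarith [h.1], h.2⟩⟩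
  -- pointwise bound on `‖∇h‖²`
  have hpt : ∀ y : ℝ × ℝ, ‖fderiv ℝ (fun y : ℝ × ℝ => χ y * g y) y‖ₑ ^ (2 : ℝ) ≤
      Q.indicator (fun y => ENNReal.ofReal (8 * ‖fderiv ℝ f (WithLp.toLp 2 ![y.2, 0, y.1])‖ ^ 2 +
        2 * (C₁ / A) ^ 2 * g y ^ 2)) y := by
    intro y
    have hχy := (hχd.differentiable one_ne_zero) y
    have hgy := (hgd.differentiable one_ne_zero) y
    have hprod : fderiv ℝ (fun y : ℝ × ℝ => χ y * g y) y = χ y • fderiv ℝ g y + g y • fderiv ℝ χ y := by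
      rw [fderiv_fun_mul hχy hgy]
    rw [← ofReal_norm, ENNReal.ofReal_rpow_of_nonneg (norm_nonneg _) (by norm_num), Real.rpow_two]
    by_cases hy : ‖y‖ ≤ 2 * A
    · rw [indicator_of_mem (hQmem y hy)]
      refine ENNReal.ofReal_le_ofReal ?_
      have h1 : ‖fderiv ℝ (fun y : ℝ × ℝ => χ y * g y) y‖ ≤ χ y * ‖fderiv ℝ g y‖ + |g y| * (C₁ / A) := by
        rw [hprod]
        refine (norm_add_le _ _).trans ?_
        rw [norm_smul, norm_smul, Real.norm_eq_abs, abs_of_nonneg (hχ01 y).1, Real.norm_eq_abs]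
        gcongr
        exact hχD y
      have h2 : χ y * ‖fderiv ℝ g y‖ ≤ 2 * ‖fderiv ℝ f (WithLp.toLp 2 ![y.2, 0, y.1])‖ := by
        calc χ y * ‖fderiv ℝ g y‖ ≤ 1 * ‖fderiv ℝ g y‖ := mul_le_mul_of_nonneg_right (hχ01 y).2 (norm_nonneg _)
          _ ≤ 2 * ‖fderiv ℝ f (WithLp.toLp 2 ![y.2, 0, y.1])‖ := by rw [one_mul]; exact hgD y
      have h3 : 0 ≤ χ y * ‖fderiv ℝ g y‖ := mul_nonneg (hχ01 y).1 (norm_nonneg _)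
      have h4 : 0 ≤ |g y| * (C₁ / A) := by positivity
      have h5 : ‖fderiv ℝ (fun y : ℝ × ℝ => χ y * g y) y‖ ^ 2 ≤ (χ y * ‖fderiv ℝ g y‖ + |g y| * (C₁ / A)) ^ 2 :=
        pow_le_pow_left₀ (norm_nonneg _) h1 2
      have h6 : (χ y * ‖fderiv ℝ g y‖) ^ 2 ≤ (2 * ‖fderiv ℝ f (WithLp.toLp 2 ![y.2, 0, y.1])‖) ^ 2 :=
        pow_le_pow_left₀ h3 h2 2
      nlinarith [h5, h6, sq_nonneg (χ y * ‖fderiv ℝ g y‖ - |g y| * (C₁ / A)), sq_abs (g y)]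
    · push Not at hy
      rw [indicator_of_notMem ?_]
      · have hz : fderiv ℝ (fun y : ℝ × ℝ => χ y * g y) y = 0 := by
          rw [hprod, hχ0 y hy.le, hχD0 y hy, zero_smul, smul_zero, add_zero]
        rw [hz, norm_zero]
        simp
      · intro hyQ
        obtain ⟨h1, h2⟩ := hyQ
        have : ‖y‖ ≤ 2 * A := max_le (abs_le.2 ⟨by linarith [h1.1], h1.2⟩) (abs_le.2 ⟨by linarith [h2.1], h2.2⟩)
        linarith
  -- integrate
  have hmerid : Continuous fun y : ℝ × ℝ => (WithLp.toLp 2 ![y.2, 0, y.1] : EuclideanSpace ℝ (Fin 3)) := by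
    refine (PiLp.continuous_toLp 2 _).comp (continuous_pi fun i => ?_)
    fin_cases i
    · exact continuous_snd
    · exact continuous_const
    · exact continuous_fst
  have hHm : Measurable fun y : ℝ × ℝ => ENNReal.ofReal (8 * ‖fderiv ℝ f (WithLp.toLp 2 ![y.2, 0, y.1])‖ ^ 2) :=
    ENNReal.measurable_ofReal.comp ((((hfd.continuous_fderiv one_ne_zero).comp hmerid).norm.pow 2).const_mul 8).measurable
  calc ∫⁻ y, ‖fderiv ℝ (fun y : ℝ × ℝ => χ y * g y) y‖ₑ ^ (2 : ℝ)
      ≤ ∫⁻ y, Q.indicator (fun y => ENNReal.ofReal (8 * ‖fderiv ℝ f (WithLp.toLp 2 ![y.2, 0, y.1])‖ ^ 2 +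
          2 * (C₁ / A) ^ 2 * g y ^ 2)) y := lintegral_mono hpt
    _ = ∫⁻ y in Q, ENNReal.ofReal (8 * ‖fderiv ℝ f (WithLp.toLp 2 ![y.2, 0, y.1])‖ ^ 2 + 2 * (C₁ / A) ^ 2 * g y ^ 2) :=
        lintegral_indicator hQm _
    _ = (∫⁻ y in Q, ENNReal.ofReal (8 * ‖fderiv ℝ f (WithLp.toLp 2 ![y.2, 0, y.1])‖ ^ 2)) +
          ∫⁻ y in Q, ENNReal.ofReal (2 * (C₁ / A) ^ 2 * g y ^ 2) := by
        rw [← lintegral_add_left hHm]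
        refine lintegral_congr fun y => ?_
        rw [ENNReal.ofReal_add (by positivity) (by positivity)]
    _ = 8 * (∫⁻ y in Q, ENNReal.ofReal (‖fderiv ℝ f (WithLp.toLp 2 ![y.2, 0, y.1])‖ ^ 2)) +
          ENNReal.ofReal (2 * (C₁ / A) ^ 2) * ∫⁻ y in Q, ENNReal.ofReal (g y ^ 2) := by
        rw [← lintegral_const_mul' _ _ (by norm_num), ← lintegral_const_mul' _ _ ENNReal.ofReal_ne_top]
        congr 1
        · refine lintegral_congr fun y => ?_
          rw [ENNReal.ofReal_mul (by norm_num)]; norm_num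
        · refine lintegral_congr fun y => ?_
          rw [ENNReal.ofReal_mul (by positivity)]
    _ ≤ 8 * (∫⁻ y in Q, ENNReal.ofReal (‖fderiv ℝ f (WithLp.toLp 2 ![y.2, 0, y.1])‖ ^ 2)) +
          ENNReal.ofReal (2 * (C₁ / A) ^ 2) * (ENNReal.ofReal (8 * A ^ 2) *
            ∫⁻ y in Q, ENNReal.ofReal (‖fderiv ℝ f (WithLp.toLp 2 ![y.2, 0, y.1])‖ ^ 2)) := by
        gcongr
        exact poincare_square hfd haxis hA
    _ = ENNReal.ofReal (8 + 16 * C₁ ^ 2) * ∫⁻ y in Q, ENNReal.ofReal (‖fderiv ℝ f (WithLp.toLp 2 ![y.2, 0, y.1])‖ ^ 2) := by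
        rw [← mul_assoc, ← ENNReal.ofReal_mul (by positivity), ← add_mul]
        congr 1
        rw [show (8 : ℝ≥0∞) = ENNReal.ofReal 8 by norm_num, ← ENNReal.ofReal_add (by norm_num) (by positivity)]
        congr 1
        field_simp
        ring

/-! ### The axis capacity floor, power-lossy form -/

/-- The closed sup-norm ball of `ℝ × ℝ` is a square: `|closedBall 0 (2A)| = (4A)²`. [folklore] -/
theorem volume_closedBall_prod (A : ℝ) (hA : 0 < A) :
    volume (closedBall (0 : ℝ × ℝ) (2 * A)) = ENNReal.ofReal (16 * A ^ 2) := by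
  rw [show (0 : ℝ × ℝ) = ((0 : ℝ), (0 : ℝ)) from rfl, ← closedBall_prod_same, Measure.volume_eq_prod, Measure.prod_prod,
    Real.closedBall_eq_Icc, Real.volume_Icc, ← ENNReal.ofReal_mul (by linarith)]
  congr 1
  ring

/-- **D2 `stub_axisCapacityFloor` of the line `swirl-capacity`, POWER-LOSSY FORM** (critic V29 P3's escape hatch; the registered
signature `Sig.stub_axisCapacityFloor = AxisCapacityFloor` is the log-sharp version, NOT claimed here): for every `q ≥ 2` there is
`K > 0` such that an axisymmetric `C¹` scalar `f` vanishing on the symmetry axis which is `≥ γ₀ > 0` on a measurable `T ⊆ B(0,A)` with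
`|T| ≥ V > 0` satisfies `∫_{B(0,3A)} ‖∇f‖²/r² ≥ K γ₀² (V/A³)^{2/q} / A`.  Proof in the module docstring (meridional reduction, cut-off +
ray Poincaré from the grounded axis, planar Gagliardo–Nirenberg–Sobolev). [folklore] -/
theorem axisCapacityFloorPow (q : ℝ) (hq : 2 ≤ q) :
    ∃ K : ℝ, 0 < K ∧ ∀ (f : EuclideanSpace ℝ (Fin 3) → ℝ) (T : Set (EuclideanSpace ℝ (Fin 3))) (A V γ₀ : ℝ),
      ContDiff ℝ 1 f → IsAxisymmetricScalar f → (∀ x : EuclideanSpace ℝ (Fin 3), cylRadius x = 0 → f x = 0) →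
      0 < A → 0 < V → 0 < γ₀ → MeasurableSet T → T ⊆ ball (0 : EuclideanSpace ℝ (Fin 3)) A →
      ENNReal.ofReal V ≤ volume T → (∀ x ∈ T, γ₀ ≤ f x) →
        ENNReal.ofReal (K * γ₀ ^ 2 * (V / A ^ 3) ^ (2 / q) / A) ≤
          ∫⁻ x in ball (0 : EuclideanSpace ℝ (Fin 3)) (3 * A), ENNReal.ofReal (‖fderiv ℝ f x‖ ^ 2 / cylRadius x ^ 2) := by
  obtain ⟨C₁, hC₁0, hbump⟩ := exists_scaled_bump
  have hq0 : 0 < q := by linarith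
  have hqR : ((q.toNNReal : ℝ≥0) : ℝ) = q := Real.coe_toNNReal q hq0.le
  have hq' : (2 : ℝ≥0) ≤ q.toNNReal := by
    rw [← NNReal.coe_le_coe, hqR]
    exact_mod_cast hq
  obtain ⟨C, hC⟩ := planar_superlevel_floor hq'
  set e : ℝ := 2 / q with he
  have he0 : 0 < e := by rw [he]; positivity
  set K₂ : ℝ := 8 + 16 * C₁ ^ 2 with hK₂
  have hK₂0 : 0 < K₂ := by rw [hK₂]; positivity
  set C' : ℝ := (C : ℝ) + 1 with hC'
  have hC'0 : 0 < C' := by rw [hC']; positivity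
  set K : ℝ := Real.pi / (2 * K₂ * C' ^ 2 * (32 * Real.pi) ^ e) with hK
  have hK0 : 0 < K := by rw [hK]; positivity
  refine ⟨K, hK0, fun f T A V γ₀ hfd hf haxis hA hV hγ₀ hTm hTA hVT hγT => ?_⟩
  obtain ⟨χ, hχd, hχ01, hχ1, hχ0, hχD0, hχD⟩ := hbump A hA
  obtain ⟨hgd, -⟩ := meridional_contDiff_and_norm_fderiv_le hfd
  -- the cut-off meridional profile `h = χ · (f ∘ m)`
  set h : ℝ × ℝ → ℝ := fun y => χ y * f (WithLp.toLp 2 ![y.2, 0, y.1]) with hh_def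
  have hh : ContDiff ℝ 1 h := hχd.mul hgd
  have hsupp : support h ⊆ closedBall (0 : ℝ × ℝ) (2 * A) := by
    intro y hy
    rw [mem_closedBall, dist_zero_right]
    by_contra hlt
    push Not at hlt
    exact hy (by simp only [hh_def, hχ0 y hlt.le, zero_mul])
  have hhc : HasCompactSupport h := HasCompactSupport.intro (isCompact_closedBall (0 : ℝ × ℝ) (2 * A))
    fun y hy => notMem_support.1 fun h' => hy (hsupp h')
  have htsupp : tsupport h ⊆ closedBall (0 : ℝ × ℝ) (2 * A) := closure_minimal hsupp isClosed_closedBall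
  -- the meridional section of the blob
  set Sec : Set (ℝ × ℝ) := {y : ℝ × ℝ | y ∈ Icc (-A) A ×ˢ Ioc (0 : ℝ) A ∧ γ₀ ≤ f (WithLp.toLp 2 ![y.2, 0, y.1])} with hSec
  have hmerid : Continuous fun y : ℝ × ℝ => (WithLp.toLp 2 ![y.2, 0, y.1] : EuclideanSpace ℝ (Fin 3)) := by
    refine (PiLp.continuous_toLp 2 _).comp (continuous_pi fun i => ?_)
    fin_cases i
    · exact continuous_snd
    · exact continuous_const
    · exact continuous_fst
  have hSecm : MeasurableSet Sec :=
    (measurableSet_Icc.prod measurableSet_Ioc).inter (isClosed_le continuous_const (hfd.continuous.comp hmerid)).measurableSet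
  have hSecval : ∀ y ∈ Sec, γ₀ ≤ h y := by
    intro y hy
    obtain ⟨⟨h1, h2⟩, h3⟩ := hy
    have hny : ‖y‖ ≤ A := max_le (abs_le.2 ⟨h1.1, h1.2⟩) (by rw [Real.norm_eq_abs, abs_of_pos h2.1]; exact h2.2)
    simp only [hh_def, hχ1 y hny, one_mul]
    exact h3
  -- (1) the planar Sobolev floor
  have hfloor := hC h (closedBall (0 : ℝ × ℝ) (2 * A)) Sec γ₀ hh hhc htsupp measurableSet_closedBall hSecm hγ₀ hSecval
  rw [hqR, volume_closedBall_prod A hA] at hfloor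
  -- (2) the energy chain
  have hE1 := cutoff_energy_le hfd haxis hA hC₁0 hχd hχ01 hχ0 hχD0 hχD
  have hE2 := square_le_two_half hf hfd A
  have hE3 : ∫⁻ y in Icc (-(2 * A)) (2 * A) ×ˢ Ioc (0 : ℝ) (2 * A), ENNReal.ofReal (‖fderiv ℝ f (WithLp.toLp 2 ![y.2, 0, y.1])‖ ^ 2) ≤
      ENNReal.ofReal (2 * A) * ∫⁻ y in Icc (-(2 * A)) (2 * A) ×ˢ Ioc (0 : ℝ) (2 * A),
        ENNReal.ofReal (‖fderiv ℝ f (WithLp.toLp 2 ![y.2, 0, y.1])‖ ^ 2 / y.2) := by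
    rw [← lintegral_const_mul' _ _ ENNReal.ofReal_ne_top]
    refine setLIntegral_mono' (measurableSet_Icc.prod measurableSet_Ioc) fun y hy => ?_
    obtain ⟨-, hρ0, hρ2⟩ := hy
    rw [← ENNReal.ofReal_mul (by positivity)]
    refine ENNReal.ofReal_le_ofReal ?_
    rw [mul_div_assoc', le_div_iff₀ hρ0]
    nlinarith [sq_nonneg ‖fderiv ℝ f (WithLp.toLp 2 ![y.2, 0, y.1])‖]
  have hE4 := meridional_energy_le hf hfd hA
  set X : ℝ≥0∞ := ∫⁻ x in ball (0 : EuclideanSpace ℝ (Fin 3)) (3 * A), ENNReal.ofReal (‖fderiv ℝ f x‖ ^ 2 / cylRadius x ^ 2) with hX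
  set Iw : ℝ≥0∞ := ∫⁻ y in Icc (-(2 * A)) (2 * A) ×ˢ Ioc (0 : ℝ) (2 * A),
    ENNReal.ofReal (‖fderiv ℝ f (WithLp.toLp 2 ![y.2, 0, y.1])‖ ^ 2 / y.2) with hIw
  have hIh : ∫⁻ y, ‖fderiv ℝ h y‖ₑ ^ (2 : ℝ) ≤ ENNReal.ofReal (4 * K₂ * A) * Iw := by
    calc ∫⁻ y, ‖fderiv ℝ h y‖ₑ ^ (2 : ℝ)
        ≤ ENNReal.ofReal K₂ * (2 * (ENNReal.ofReal (2 * A) * Iw)) := hE1.trans (by gcongr; exact hE2.trans (by gcongr))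
      _ = ENNReal.ofReal (4 * K₂ * A) * Iw := by
          rw [show (2 : ℝ≥0∞) = ENNReal.ofReal 2 by norm_num, ← mul_assoc, ← mul_assoc, ← ENNReal.ofReal_mul hK₂0.le,
            ← ENNReal.ofReal_mul (by positivity)]
          congr 1
          ring
  -- (3) volumes
  have hvolT := volume_le_meridional_section hf hfd.continuous hA hTA hγT
  have hV' : ENNReal.ofReal V ^ e ≤ ENNReal.ofReal (2 * Real.pi * A) ^ e * volume Sec ^ e := by
    rw [← ENNReal.mul_rpow_of_nonneg _ _ he0.le]
    exact ENNReal.rpow_le_rpow (hVT.trans hvolT) he0.le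
  -- (4) combine in `ℝ≥0∞`
  have hCC : (C : ℝ≥0∞) ^ (2 : ℝ) ≤ ENNReal.ofReal (C' ^ 2) := by
    have h1 : (C : ℝ≥0∞) ≤ ENNReal.ofReal C' := by
      rw [← ENNReal.ofReal_coe_nnreal]
      exact ENNReal.ofReal_le_ofReal (by rw [hC']; linarith)
    calc (C : ℝ≥0∞) ^ (2 : ℝ) ≤ (ENNReal.ofReal C') ^ (2 : ℝ) := ENNReal.rpow_le_rpow h1 (by norm_num)
      _ = ENNReal.ofReal (C' ^ 2) := by
          rw [ENNReal.ofReal_rpow_of_nonneg hC'0.le (by norm_num), Real.rpow_two]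
  have hmain : ENNReal.ofReal (2 * Real.pi * γ₀ ^ 2 * V ^ e) ≤
      ENNReal.ofReal ((2 * Real.pi * A) ^ e * C' ^ 2 * (16 * A ^ 2) ^ e * (4 * K₂ * A)) * X := by
    have hl : ENNReal.ofReal (2 * Real.pi * γ₀ ^ 2 * V ^ e) =
        ENNReal.ofReal (2 * Real.pi) * ENNReal.ofReal γ₀ ^ (2 : ℝ) * ENNReal.ofReal V ^ e := by
      rw [ENNReal.ofReal_rpow_of_nonneg hγ₀.le (by norm_num), ENNReal.ofReal_rpow_of_nonneg hV.le he0.le, Real.rpow_two,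
        ← ENNReal.ofReal_mul (by positivity), ← ENNReal.ofReal_mul (by positivity)]
    have hr : ENNReal.ofReal ((2 * Real.pi * A) ^ e * C' ^ 2 * (16 * A ^ 2) ^ e * (4 * K₂ * A)) =
        ENNReal.ofReal (2 * Real.pi * A) ^ e * ENNReal.ofReal (C' ^ 2) * ENNReal.ofReal (16 * A ^ 2) ^ e *
          ENNReal.ofReal (4 * K₂ * A) := by
      rw [ENNReal.ofReal_rpow_of_nonneg (by positivity) he0.le, ENNReal.ofReal_rpow_of_nonneg (by positivity) he0.le,
        ← ENNReal.ofReal_mul (by positivity), ← ENNReal.ofReal_mul (by positivity), ← ENNReal.ofReal_mul (by positivity)]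
    rw [hl, hr]
    calc ENNReal.ofReal (2 * Real.pi) * ENNReal.ofReal γ₀ ^ (2 : ℝ) * ENNReal.ofReal V ^ e
        ≤ ENNReal.ofReal (2 * Real.pi) * ENNReal.ofReal γ₀ ^ (2 : ℝ) *
            (ENNReal.ofReal (2 * Real.pi * A) ^ e * volume Sec ^ e) := by gcongr
      _ = ENNReal.ofReal (2 * Real.pi * A) ^ e * (ENNReal.ofReal γ₀ ^ (2 : ℝ) * volume Sec ^ e) * ENNReal.ofReal (2 * Real.pi) := by
          ring
      _ ≤ ENNReal.ofReal (2 * Real.pi * A) ^ e *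
            ((C : ℝ≥0∞) ^ (2 : ℝ) * ENNReal.ofReal (16 * A ^ 2) ^ e * ∫⁻ y, ‖fderiv ℝ h y‖ₑ ^ (2 : ℝ)) *
              ENNReal.ofReal (2 * Real.pi) := by gcongr
      _ ≤ ENNReal.ofReal (2 * Real.pi * A) ^ e *
            (ENNReal.ofReal (C' ^ 2) * ENNReal.ofReal (16 * A ^ 2) ^ e * (ENNReal.ofReal (4 * K₂ * A) * Iw)) *
              ENNReal.ofReal (2 * Real.pi) := by gcongr
      _ = ENNReal.ofReal (2 * Real.pi * A) ^ e * ENNReal.ofReal (C' ^ 2) * ENNReal.ofReal (16 * A ^ 2) ^ e *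
            ENNReal.ofReal (4 * K₂ * A) * (ENNReal.ofReal (2 * Real.pi) * Iw) := by ring
      _ ≤ ENNReal.ofReal (2 * Real.pi * A) ^ e * ENNReal.ofReal (C' ^ 2) * ENNReal.ofReal (16 * A ^ 2) ^ e *
            ENNReal.ofReal (4 * K₂ * A) * X := by gcongr
  -- (5) back to real numbers
  set m : ℝ := (2 * Real.pi * A) ^ e * C' ^ 2 * (16 * A ^ 2) ^ e * (4 * K₂ * A) with hm
  have hm0 : 0 < m := by rw [hm]; positivity
  have hdiv : ENNReal.ofReal (2 * Real.pi * γ₀ ^ 2 * V ^ e / m) ≤ X := by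
    rw [ENNReal.ofReal_div_of_pos hm0]
    exact ENNReal.div_le_of_le_mul' hmain
  refine le_trans (ENNReal.ofReal_le_ofReal (le_of_eq ?_)) hdiv
  -- the identity `K γ₀² (V/A³)^e / A = 2π γ₀² V^e / m`
  have hVA : (V / A ^ 3) ^ e = V ^ e / (A ^ 3) ^ e := Real.div_rpow hV.le (by positivity) e
  have hprod : (2 * Real.pi * A) ^ e * (16 * A ^ 2) ^ e = (32 * Real.pi) ^ e * (A ^ 3) ^ e := by
    rw [← Real.mul_rpow (by positivity) (by positivity), ← Real.mul_rpow (by positivity) (by positivity)]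
    congr 1
    ring
  have hm' : m = (32 * Real.pi) ^ e * (A ^ 3) ^ e * C' ^ 2 * (4 * K₂ * A) := by
    rw [hm, ← hprod]; ring
  have hP : 0 < (32 * Real.pi) ^ e := by positivity
  have hQ : 0 < (A ^ 3) ^ e := by positivity
  rw [hVA, hm', hK]
  field_simp
  ring

end Summit.NavierStokesRegularity.NavierStokesRegularity.Theorems.PowerGaugeEulerLiouville.SwirlCapacity

end
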